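import Literature.AnabelianGeometry.SemiGraphs.QuasiTemperoidsThmA4Fibre
import Literature.AnabelianGeometry.SemiGraphs.QuasiTemperoidsThmA4Unique
import Literature.AnabelianGeometry.SemiGraphs.TemperoidsGaloisTorsorProofs
import Literature.AnabelianGeometry.SemiGraphs.TemperoidsGaloisObjectsProofs
import Literature.AnabelianGeometry.SemiGraphs.TemperoidsHomTorsor
import Mathlib.Algebra.Group.Shrink
import Mathlib.Data.Countable.Small
import HarnessLib

/-!
# Semi-graphs of anabelioids, Appendix: Theorem A.4 (chart route) — the torsors `F(Π₂/N)` of a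
# morphism of connected quasi-temperoids

Mochizuki, *Semi-graphs of anabelioids*, Publ. RIMS **42** (2006), Appendix, Theorem A.4 (manuscript
pp. 82–86) [cite: MochizukiSemiAnbd2006, Thm A.4 pp.82-86].  PROOF-ONLY port (no definitions) of the
tree's `TemperoidsHomTorsor.lean` (abc-iut-L3-d2; [SemiAnbd] Prop. 3.2 engine) to a functor
`F : T₂[A₂] ⥤ T₁[A₁]` (`T[A] = Over' A ⊆ B^temp(Π)`) preserving finite limits, countable colimits and
nondegenerate objects: for an open normal `N ≤ Stab(a₂)` of the tempered group `Π₂`, with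
`Q_N = Π₂/N ∈ T₂[A₂]` the Galois object over `A₂` (`ThmA4Chart.Q`),

* `map_orbitMap` — `F` of an orbit map `Π₂/N → X` (`X ∈ T₂[A₂]` transitive) is surjective with fibres the
  orbits of the stabiliser under the right action `F(r_h)` (the orbit map is the quotient of `Π₂/N` by the
  countable group `HN/N`, preserved by `F`: `map_quotient`);
* `fibreQ_transitive` — `Y_N := F(Q_N)` is NONEMPTY (`map_nonempty`: nondegeneracy replaces the
  one-point object of Prop. 3.2, which `T[A]` lacks) and `Π₂` acts TRANSITIVELY on it by the `F(r_g)` —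
  NEW argument, the chart-level form of the Galois square of the printed proof (pp. 85–86): `Q_N` is
  Galois, so the first projection `Q_N × Q_N → Q_N` is the quotient by `Aut(Q_N)` acting on the second
  factor; `F` preserves the product and this quotient, and every automorphism of `Π₂/N` is a right
  multiplication;
* `fibreQ_free`, `fibreQ_coe_eq_of_rightMul_eq` — `Π₂/N` acts freely (`map_fixedPointFree`).

So `Y_N` is a `Π₂/N`-torsor with a commuting `Π₁`-action, as in Prop. 3.2; the extraction of the
continuous homomorphism (port of `TemperoidsHomHom`) and the comparison `θ` (port of
`TemperoidsHomEqResProofs`) are the sequel files (L3-lead μ3-1/ν3-1 rows C-S1b/C-S1c).  Galois-countability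
is NOT used here.  Nothing takes a side on [IUTchIII] Cor. 3.12.
-/

namespace Literature.AnabelianGeometry.SemiGraphs

namespace ThmA4Chart

open CategoryTheory CategoryTheory.Limits Topology
open Literature.AlgebraicGeometry.Frobenioids (IsConnectedObj IsNonemptyObj)
open Literature.AlgebraicGeometry.Frobenioids.QuasiTemperoid.BTempConnected (hom_ρ hom_eq_of_apply_eq
  hom_ext_apply)

universe u

/-! ### Bookkeeping on `Π/N` over `A` -/

section Bookkeeping

variable {G : Type u} [Group G] [TopologicalSpace G] [IsTopologicalGroup G] (hG : IsTempered G)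
  (A : BTemp G) (a : A.obj.V)

/-- `r_a ≫ r_b = r_{ab}` over `A`. [cite: MochizukiSemiAnbd2006, Rmk 3.1.2 p.33] -/
theorem rightMul_comp (N : OpenNormalSubgroup G) (hN : N.toSubgroup ≤ BTemp.stab A a) (g g' : G) :
    rightMul hG A a N hN g ≫ rightMul hG A a N hN g' = rightMul hG A a N hN (g * g') :=
  ObjectProperty.hom_ext _ (BTemp.rightMul_comp hG N g g')

/-- `r_1 = 𝟙` over `A`. [cite: MochizukiSemiAnbd2006, Rmk 3.1.2 p.33] -/
theorem rightMul_one (N : OpenNormalSubgroup G) (hN : N.toSubgroup ≤ BTemp.stab A a) :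
    rightMul hG A a N hN 1 = 𝟙 (Q hG A a N hN) :=
  ObjectProperty.hom_ext _ (BTemp.rightMul_one hG N)

/-- Every automorphism of the Galois object `Π/N` of `B^temp(Π)` is a right multiplication (it is
determined by the image of the coset `N`). [cite: MochizukiSemiAnbd2006, Rmk 3.1.3 p.34] -/
theorem exists_hom_eq_rightMul (N : OpenNormalSubgroup G) (σ : BTemp.Q hG N ≅ BTemp.Q hG N) :
    ∃ g : G, σ.hom = BTemp.rightMul hG N g := by
  obtain ⟨g, hg⟩ := QuotientGroup.mk_surjective (σ.hom.hom.hom ((1 : G) : G ⧸ N.toSubgroup))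
  refine ⟨g, hom_eq_of_apply_eq (GaloisObjects.isConnectedObj_quotientObj hG _ _) _ _
    ((1 : G) : G ⧸ N.toSubgroup) ?_⟩
  rw [BTemp.rightMul_apply, one_mul]
  exact hg.symm

end Bookkeeping

/-! ### The engine's data -/

variable {G₁ : Type u} [Group G₁] [TopologicalSpace G₁] [IsTopologicalGroup G₁]
  {G₂ : Type u} [Group G₂] [TopologicalSpace G₂] [IsTopologicalGroup G₂] (hG₂ : IsTempered G₂)
  {A₁ : BTemp G₁} (hA₁ : IsConnectedObj A₁) {A₂ : BTemp G₂} (a₂ : A₂.obj.V)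
  (F : Over' A₂ ⥤ Over' A₁) (hlim : PreservesFiniteLimits F)
  (hcolim : ∀ (J : Type) [SmallCategory J] [CountableCategory J], PreservesColimitsOfShape J F)
  (hnd : ∀ X : Over' A₂, IsNondegenerateObj X → IsNondegenerateObj (F.obj X))

/-! ### `Y_N = F(Π₂/N)` is a nonempty transitive `Π₂`-set under the `F(r_g)` -/

include hlim hcolim hnd hA₁ in
/-- **`Y_N = F(Π₂/N)` is nonempty and `Π₂` acts transitively on it by the `F(r_g)`** — the Galois square
of [SemiAnbd] App. pp. 85–86 at chart level: `Q_N × Q_N → Q_N` (first projection) is the quotient of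
`Q_N × Q_N` by `Aut(Q_N)` acting on the second factor (fibres: `Q_N` is Galois), `F` preserves the binary
product and this countable quotient, and `Aut(Π₂/N)` consists of right multiplications; nonemptiness is
`map_nonempty` (nondegeneracy). [cite: MochizukiSemiAnbd2006, Thm A.4 pp.82-86] -/
theorem fibreQ_transitive (N : OpenNormalSubgroup G₂) (hN : N.toSubgroup ≤ BTemp.stab A₂ a₂) :
    Nonempty (F.obj (Q hG₂ A₂ a₂ N hN)).obj.obj.V ∧
    ∀ y y' : (F.obj (Q hG₂ A₂ a₂ N hN)).obj.obj.V,
      ∃ g : G₂, (F.map (rightMul hG₂ A₂ a₂ N hN g)).hom.hom.hom y = y' := by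
  classical
  refine ⟨map_nonempty hG₂ hA₁ F hnd (Q hG₂ A₂ a₂ N hN) ⟨((1 : G₂) : G₂ ⧸ N.toSubgroup)⟩,
    fun u v => ?_⟩
  -- the Galois object `B = Π₂/N` and a product `B × B`
  let Q' : Over' A₂ := Q hG₂ A₂ a₂ N hN
  let B : BTemp G₂ := BTemp.Q hG₂ N
  have hBc : IsConnectedObj B := GaloisObjects.isConnectedObj_quotientObj hG₂ _ _
  have hBg : IsGaloisObj B := GaloisObjects.isGaloisObj_of_iso_quotientObj hG₂ B N (Iso.refl _)
  haveI : HasLimitsOfShape (Discrete WalkingPair) (BTemp G₂) :=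
    BTemp.hasLimitsOfShape_of_finCategory _
  haveI : HasLimitsOfShape (Discrete WalkingPair) (BTemp G₁) :=
    BTemp.hasLimitsOfShape_of_finCategory _
  have hP : IsLimit (BinaryFan.mk (prod.fst : B ⨯ B ⟶ B) prod.snd) := prodIsProd B B
  let P' : Over' A₂ := ⟨B ⨯ B, ⟨prod.fst ≫ BTemp.orbitMap hG₂ A₂ a₂ N hN⟩⟩
  let fst' : P' ⟶ Q' := ObjectProperty.homMk prod.fst
  let snd' : P' ⟶ Q' := ObjectProperty.homMk prod.snd
  have hP' : IsLimit (BinaryFan.mk fst' snd') :=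
    isLimitOfReflectsOfMapIsLimit (admitsHomTo A₂).ι fst' snd' hP
  -- `F` of it is a product in `T₁[A₁]`, hence in `B^temp(Π₁)`
  haveI : PreservesLimitsOfShape (Discrete WalkingPair) F := hlim.preservesFiniteLimits _
  have hFP' : IsLimit (BinaryFan.mk (F.map fst') (F.map snd')) :=
    mapIsLimitOfPreservesOfIsLimit F fst' snd' hP'
  haveI := admitsHomTo_isClosedUnderLimitsOfShape A₁ (Discrete WalkingPair)
  have hFP : IsLimit (BinaryFan.mk (F.map fst').hom (F.map snd').hom) :=
    mapIsLimitOfPreservesOfIsLimit (admitsHomTo A₁).ι (F.map fst') (F.map snd') hFP'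
  -- `Aut B` is countable (an automorphism is determined by the image of one point); a small copy
  haveI : Countable (G₂ ⧸ N.toSubgroup) := hG₂.countable_quotient N.toSubgroup N.isOpen'
  haveI : Countable (Aut B) := by
    refine Function.Injective.countable
      (f := fun σ : Aut B =>
        (show G₂ ⧸ N.toSubgroup from σ.hom.hom.hom ((1 : G₂) : G₂ ⧸ N.toSubgroup))) ?_
    intro σ τ h
    exact GaloisTorsor.iso_eq_of_apply_eq B hBc σ τ ((1 : G₂) : G₂ ⧸ N.toSubgroup) h
  let K : Type := Shrink.{0} (Aut B)
  haveI : Countable K := Countable.of_equiv (Aut B) (equivShrink.{0} (Aut B))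
  let e : K ≃* Aut B := Shrink.mulEquiv
  -- `Aut B` acting on the second factor of `B × B`, as endomorphisms of `P'`
  let r : Aut B → (P' ⟶ P') := fun σ => ObjectProperty.homMk (prod.map (𝟙 B) σ.hom)
  have r_fst : ∀ σ, r σ ≫ fst' = fst' := fun σ =>
    ObjectProperty.hom_ext _ (by
      change prod.map (𝟙 B) σ.hom ≫ prod.fst = prod.fst
      rw [prod.map_fst, Category.comp_id])
  have r_snd : ∀ σ : Aut B, r σ ≫ snd' = snd' ≫ (ObjectProperty.homMk σ.hom : Q' ⟶ Q') := fun σ =>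
    ObjectProperty.hom_ext _ (by
      change prod.map (𝟙 B) σ.hom ≫ prod.snd = prod.snd ≫ σ.hom
      rw [prod.map_snd])
  let act : K →* End P' :=
    { toFun := fun k => r (e k)
      map_one' := by
        apply ObjectProperty.hom_ext
        change prod.map (𝟙 B) (e 1).hom = 𝟙 (B ⨯ B)
        rw [map_one]
        exact prod.map_id_id
      map_mul' := fun k k' => by
        apply ObjectProperty.hom_ext
        change prod.map (𝟙 B) (e (k * k')).hom = prod.map (𝟙 B) (e k').hom ≫ prod.map (𝟙 B) (e k).hom
        rw [map_mul, prod.map_map, Category.comp_id]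
        rfl }
  have act_apply : ∀ k, (act k : End P') = r (e k) := fun k => rfl
  -- the first projection is the quotient by this action: surjective, fibres = orbits
  have hπ : ∀ k, act k ≫ fst' = fst' := fun k => r_fst (e k)
  have hsurj : ∀ b : Q'.obj.obj.V, ∃ p : P'.obj.obj.V, fst'.hom.hom.hom p = b := fun b => by
    obtain ⟨p, hp, -⟩ := BTemp.exists_point_of_isLimit_binaryFan (prod.fst : B ⨯ B ⟶ B) prod.snd hP b b
    exact ⟨p, hp⟩
  have hfib : ∀ p p' : P'.obj.obj.V, fst'.hom.hom.hom p = fst'.hom.hom.hom p' →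
      ∃ k, (act k).hom.hom.hom p = p' := by
    intro p p' h
    obtain ⟨σ, hσ⟩ := GaloisTorsor.exists_aut_apply_eq_of_isGaloisObj B hBg
      ((prod.snd : B ⨯ B ⟶ B).hom.hom p) ((prod.snd : B ⨯ B ⟶ B).hom.hom p')
    refine ⟨e.symm σ, ?_⟩
    rw [act_apply, MulEquiv.apply_symm_apply]
    apply GaloisTorsor.binaryFan_ext (BinaryFan.mk (prod.fst : B ⨯ B ⟶ B) prod.snd) hP
    · change ((prod.fst : B ⨯ B ⟶ B).hom.hom ((prod.map (𝟙 B) σ.hom).hom.hom p) : B.obj.V) =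
        (prod.fst : B ⨯ B ⟶ B).hom.hom p'
      have e₁ := congrArg (fun φ : B ⨯ B ⟶ B => (φ.hom.hom p : B.obj.V)) (prod.map_fst (𝟙 B) σ.hom)
      simp only at e₁
      exact (e₁.trans (by rw [Category.comp_id]; exact h))
    · change ((prod.snd : B ⨯ B ⟶ B).hom.hom ((prod.map (𝟙 B) σ.hom).hom.hom p) : B.obj.V) =
        (prod.snd : B ⨯ B ⟶ B).hom.hom p'
      have e₂ := congrArg (fun φ : B ⨯ B ⟶ B => (φ.hom.hom p : B.obj.V)) (prod.map_snd (𝟙 B) σ.hom)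
      simp only at e₂
      exact e₂.trans hσ
  obtain ⟨-, hf⟩ := map_quotient F hcolim act fst' hπ hsurj hfib
  -- points of `F(P')` over `(u, u)` and `(u, v)`
  obtain ⟨p₁, hp₁, hp₁'⟩ :=
    BTemp.exists_point_of_isLimit_binaryFan (F.map fst').hom (F.map snd').hom hFP u u
  obtain ⟨p₂, hp₂, hp₂'⟩ :=
    BTemp.exists_point_of_isLimit_binaryFan (F.map fst').hom (F.map snd').hom hFP u v
  obtain ⟨k, hk⟩ := (hf p₁ p₂).mp (hp₁.trans hp₂.symm)
  -- the automorphism `e k` is a right multiplication `r_g`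
  obtain ⟨g, hg⟩ := exists_hom_eq_rightMul hG₂ N (e k)
  refine ⟨g, ?_⟩
  have hσ' : (ObjectProperty.homMk (e k).hom : Q' ⟶ Q') = rightMul hG₂ A₂ a₂ N hN g :=
    ObjectProperty.hom_ext _ hg
  -- `F(snd') ∘ F(act k) = F(r_g) ∘ F(snd')`
  have hcomp : F.map (act k : End P') ≫ F.map snd' = F.map snd' ≫ F.map (rightMul hG₂ A₂ a₂ N hN g) := by
    rw [← F.map_comp, ← F.map_comp, act_apply, r_snd, hσ']
  have := congrArg (fun φ : F.obj P' ⟶ F.obj Q' => (φ.hom.hom.hom p₁ : (F.obj Q').obj.obj.V)) hcomp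
  change ((F.map snd').hom.hom.hom ((F.map (act k : End P')).hom.hom.hom p₁) : (F.obj Q').obj.obj.V) =
    (F.map (rightMul hG₂ A₂ a₂ N hN g)).hom.hom.hom ((F.map snd').hom.hom.hom p₁) at this
  rw [hk] at this
  rw [← hp₁', ← this, hp₂']

/-! ### Freeness -/

include hlim hcolim in
/-- `Π₂/N` acts freely on `Y_N = F(Π₂/N)`: `F(r_g)` has no fixed point unless `g ∈ N` (`r_g` is
fixed-point-free on `Π₂/N`, and `F` preserves that). [cite: MochizukiSemiAnbd2006, Thm A.4 pp.82-86] -/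
theorem fibreQ_free (N : OpenNormalSubgroup G₂) (hN : N.toSubgroup ≤ BTemp.stab A₂ a₂) {g : G₂}
    (hg : g ∉ N.toSubgroup) (y : (F.obj (Q hG₂ A₂ a₂ N hN)).obj.obj.V) :
    (F.map (rightMul hG₂ A₂ a₂ N hN g)).hom.hom.hom y ≠ y := by
  apply map_fixedPointFree F hlim hcolim
  intro q hq
  obtain ⟨z, rfl⟩ := QuotientGroup.mk_surjective q
  change (BTemp.rightMul hG₂ N g).hom.hom (z : G₂ ⧸ N.toSubgroup) = (z : G₂ ⧸ N.toSubgroup) at hq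
  rw [BTemp.rightMul_apply] at hq
  change ((z * g : G₂) : G₂ ⧸ N.toSubgroup) = (z : G₂ ⧸ N.toSubgroup) at hq
  rw [QuotientGroup.eq, mul_inv_rev, mul_assoc, inv_mul_cancel, mul_one] at hq
  exact hg ((Subgroup.inv_mem_iff _).mp hq)

include hlim hcolim in
/-- Freeness, injective form: `F(r_g) y = F(r_{g'}) y` forces `g ≡ g' (mod N)`.
[cite: MochizukiSemiAnbd2006, Thm A.4 pp.82-86] -/
theorem fibreQ_coe_eq_of_rightMul_eq (N : OpenNormalSubgroup G₂) (hN : N.toSubgroup ≤ BTemp.stab A₂ a₂)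
    {g g' : G₂} {y : (F.obj (Q hG₂ A₂ a₂ N hN)).obj.obj.V}
    (h : (F.map (rightMul hG₂ A₂ a₂ N hN g)).hom.hom.hom y =
      (F.map (rightMul hG₂ A₂ a₂ N hN g')).hom.hom.hom y) :
    (g : G₂ ⧸ N.toSubgroup) = g' := by
  have h1 : (F.map (rightMul hG₂ A₂ a₂ N hN (g * g'⁻¹))).hom.hom.hom y = y := by
    have h2 := congrArg (fun w => (F.map (rightMul hG₂ A₂ a₂ N hN g'⁻¹)).hom.hom.hom w) h
    simp only at h2
    change (F.map (rightMul hG₂ A₂ a₂ N hN g) ≫ F.map (rightMul hG₂ A₂ a₂ N hN g'⁻¹)).hom.hom.hom y =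
      (F.map (rightMul hG₂ A₂ a₂ N hN g') ≫ F.map (rightMul hG₂ A₂ a₂ N hN g'⁻¹)).hom.hom.hom y at h2
    rw [← F.map_comp, ← F.map_comp, rightMul_comp, rightMul_comp, mul_inv_cancel,
      rightMul_one, F.map_id] at h2
    exact h2
  by_contra hne
  refine fibreQ_free hG₂ a₂ F hlim hcolim N hN ?_ y h1
  intro hmem
  apply hne
  rw [← mul_inv_eq_one, ← QuotientGroup.mk_inv, ← QuotientGroup.mk_mul]
  exact (QuotientGroup.eq_one_iff _).mpr hmem

/-! ### `F` of an orbit map -/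

include hcolim in
/-- `F` of an orbit map `Π₂/N → X`, `gN ↦ g · x₀` (`X ∈ T₂[A₂]` transitive, `N` fixing `x₀` and the base
point `a₂`) is surjective with fibres the orbits of the stabiliser `H` of `x₀` under the right action
`F(r_h)`: the orbit map is the quotient of `Π₂/N` by the countable group `HN/N`, and `F` preserves
countable quotients (`map_quotient`; port of `BTemp.map_orbitMap`). For `X = A₂` this is `F` of the
structure map `Π₂/N → A₂`. [cite: MochizukiSemiAnbd2006, Thm A.4 pp.82-86] -/
theorem map_orbitMap (N : OpenNormalSubgroup G₂) (hN : N.toSubgroup ≤ BTemp.stab A₂ a₂) (X : Over' A₂)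
    (x₀ : X.obj.obj.V) (htr : ∀ x : X.obj.obj.V, ∃ g : G₂, X.obj.obj.ρ g x₀ = x)
    (hNx : N.toSubgroup ≤ BTemp.stab X.obj x₀) :
    (∀ z : (F.obj X).obj.obj.V, ∃ y : (F.obj (Q hG₂ A₂ a₂ N hN)).obj.obj.V,
        (F.map (orbitMap hG₂ A₂ a₂ X x₀ N hN hNx)).hom.hom.hom y = z) ∧
    ∀ y y' : (F.obj (Q hG₂ A₂ a₂ N hN)).obj.obj.V,
      (F.map (orbitMap hG₂ A₂ a₂ X x₀ N hN hNx)).hom.hom.hom y =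
          (F.map (orbitMap hG₂ A₂ a₂ X x₀ N hN hNx)).hom.hom.hom y' ↔
        ∃ h ∈ BTemp.stab X.obj x₀, (F.map (rightMul hG₂ A₂ a₂ N hN h)).hom.hom.hom y = y' := by
  classical
  let Q' : Over' A₂ := Q hG₂ A₂ a₂ N hN
  -- the subgroup `L = HN/N` of `Π₂/N` (`H` the stabiliser of `x₀`) and a small copy `K` of it
  let L : Subgroup (G₂ ⧸ N.toSubgroup) := (BTemp.stab X.obj x₀).map (QuotientGroup.mk' N.toSubgroup)
  haveI : Countable (G₂ ⧸ N.toSubgroup) := hG₂.countable_quotient N.toSubgroup N.isOpen'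
  let K : Type := Shrink.{0} L
  haveI : Countable K := Countable.of_equiv (↥L) (equivShrink.{0} (↥L))
  let e : K ≃* L := Shrink.mulEquiv
  -- right multiplication by a coset, as an endomorphism of `Π₂/N` over `A₂`
  have hequiv : ∀ (m : G₂ ⧸ N.toSubgroup) (g : G₂) (q : G₂ ⧸ N.toSubgroup),
      (fun q : G₂ ⧸ N.toSubgroup => q * m) ((BTemp.Q hG₂ N).obj.ρ g q) =
        (BTemp.Q hG₂ N).obj.ρ g ((fun q : G₂ ⧸ N.toSubgroup => q * m) q) := by
    intro m g q
    obtain ⟨z, rfl⟩ := QuotientGroup.mk_surjective q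
    obtain ⟨w, rfl⟩ := QuotientGroup.mk_surjective m
    simp only [BTemp.Q_ρ_apply, ← QuotientGroup.mk_mul, mul_assoc]
  let r : (G₂ ⧸ N.toSubgroup) → (Q' ⟶ Q') := fun m =>
    ObjectProperty.homMk
      (BTemp.homOfEquivariant (BTemp.Q hG₂ N) (BTemp.Q hG₂ N) (fun q : G₂ ⧸ N.toSubgroup => q * m)
        (hequiv m))
  have r_apply : ∀ m (q : G₂ ⧸ N.toSubgroup), (r m).hom.hom.hom q = q * m := fun m q => rfl
  have r_eq_rightMul : ∀ w : G₂, r (w : G₂ ⧸ N.toSubgroup) = rightMul hG₂ A₂ a₂ N hN w := fun w =>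
    ObjectProperty.hom_ext _ (hom_ext_apply fun q => by
      change (r (w : G₂ ⧸ N.toSubgroup)).hom.hom.hom q = (BTemp.rightMul hG₂ N w).hom.hom q
      rw [r_apply, BTemp.rightMul_apply'])
  let a : K →* End Q' :=
    { toFun := fun k => r ((e k : L) : G₂ ⧸ N.toSubgroup)⁻¹
      map_one' := by
        apply ObjectProperty.hom_ext
        apply hom_ext_apply
        intro q
        change (r _).hom.hom.hom q = q
        rw [r_apply, map_one, OneMemClass.coe_one, inv_one, mul_one]
      map_mul' := fun k k' => by
        apply ObjectProperty.hom_ext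
        apply hom_ext_apply
        intro q
        change (r _).hom.hom.hom q = (r _).hom.hom.hom ((r _).hom.hom.hom q)
        rw [r_apply, r_apply, r_apply, map_mul, Subgroup.coe_mul, mul_inv_rev, mul_assoc] }
  have a_apply : ∀ k, (a k : End Q') = r ((e k : L) : G₂ ⧸ N.toSubgroup)⁻¹ := fun k => rfl
  -- every `a k` is an `r_h`, `h ∈ H`, and conversely
  have hak : ∀ k : K, ∃ h ∈ BTemp.stab X.obj x₀, (a k : End Q') = rightMul hG₂ A₂ a₂ N hN h := by
    intro k
    obtain ⟨h, hh, hhk⟩ := Subgroup.mem_map.mp (L.inv_mem (e k).2)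
    refine ⟨h, hh, ?_⟩
    rw [a_apply, ← r_eq_rightMul, ← hhk, QuotientGroup.mk'_apply]
  have hka : ∀ h ∈ BTemp.stab X.obj x₀, ∃ k : K, (a k : End Q') = rightMul hG₂ A₂ a₂ N hN h := by
    intro h hh
    have hmem : ((h : G₂ ⧸ N.toSubgroup))⁻¹ ∈ L :=
      L.inv_mem (Subgroup.mem_map.mpr ⟨h, hh, rfl⟩)
    refine ⟨e.symm ⟨_, hmem⟩, ?_⟩
    rw [a_apply, MulEquiv.apply_symm_apply, Subgroup.coe_mk, inv_inv, r_eq_rightMul]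
  -- the orbit map is invariant, surjective, with fibres the `L`-orbits
  have hρmul : ∀ (g g' : G₂) (x : X.obj.obj.V),
      X.obj.obj.ρ (g * g') x = X.obj.obj.ρ g (X.obj.obj.ρ g' x) := by
    intro g g' x
    rw [map_mul]
    rfl
  have hπapply : ∀ z : G₂, (orbitMap hG₂ A₂ a₂ X x₀ N hN hNx).hom.hom.hom (z : G₂ ⧸ N.toSubgroup) =
      X.obj.obj.ρ z x₀ := fun z => BTemp.orbitMap_apply hG₂ X.obj x₀ N hNx z
  have hπa : ∀ k, a k ≫ orbitMap hG₂ A₂ a₂ X x₀ N hN hNx = orbitMap hG₂ A₂ a₂ X x₀ N hN hNx := by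
    intro k
    obtain ⟨h, hh, hk⟩ := hak k
    rw [hk]
    apply ObjectProperty.hom_ext
    apply hom_ext_apply
    intro q
    obtain ⟨z, rfl⟩ := QuotientGroup.mk_surjective q
    change (orbitMap hG₂ A₂ a₂ X x₀ N hN hNx).hom.hom.hom
        ((BTemp.rightMul hG₂ N h).hom.hom (z : G₂ ⧸ N.toSubgroup)) =
      (orbitMap hG₂ A₂ a₂ X x₀ N hN hNx).hom.hom.hom (z : G₂ ⧸ N.toSubgroup)
    rw [BTemp.rightMul_apply, hπapply, hπapply, hρmul]
    exact congrArg _ hh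
  have hsurj : ∀ w : X.obj.obj.V, ∃ q : Q'.obj.obj.V,
      (orbitMap hG₂ A₂ a₂ X x₀ N hN hNx).hom.hom.hom q = w := by
    intro w
    obtain ⟨g, hg⟩ := htr w
    exact ⟨(g : G₂ ⧸ N.toSubgroup), by rw [hπapply]; exact hg⟩
  have hfib : ∀ q q' : Q'.obj.obj.V,
      (orbitMap hG₂ A₂ a₂ X x₀ N hN hNx).hom.hom.hom q =
        (orbitMap hG₂ A₂ a₂ X x₀ N hN hNx).hom.hom.hom q' → ∃ k, (a k).hom.hom.hom q = q' := by
    intro q q' hqq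
    obtain ⟨z, rfl⟩ := QuotientGroup.mk_surjective q
    obtain ⟨z', rfl⟩ := QuotientGroup.mk_surjective q'
    rw [hπapply, hπapply] at hqq
    have hmem' : z⁻¹ * z' ∈ BTemp.stab X.obj x₀ := by
      change X.obj.obj.ρ (z⁻¹ * z') x₀ = x₀
      rw [hρmul, ← hqq, ← hρmul, inv_mul_cancel, map_one]
      rfl
    have hmem : ((z⁻¹ * z' : G₂) : G₂ ⧸ N.toSubgroup) ∈ L :=
      Subgroup.mem_map.mpr ⟨_, hmem', rfl⟩
    refine ⟨(e.symm ⟨_, hmem⟩)⁻¹, ?_⟩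
    change (r _).hom.hom.hom (z : G₂ ⧸ N.toSubgroup) = (z' : G₂ ⧸ N.toSubgroup)
    rw [r_apply, map_inv, MulEquiv.apply_symm_apply, InvMemClass.coe_inv, Subgroup.coe_mk, inv_inv,
      ← QuotientGroup.mk_mul, mul_inv_cancel_left]
  obtain ⟨hs, hf⟩ := map_quotient F hcolim a (orbitMap hG₂ A₂ a₂ X x₀ N hN hNx) hπa hsurj hfib
  refine ⟨hs, fun y y' => (hf y y').trans ⟨?_, ?_⟩⟩
  · rintro ⟨k, hk⟩
    obtain ⟨h, hh, hkh⟩ := hak k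
    refine ⟨h, hh, ?_⟩
    rw [← hk]
    change _ = (F.map (a k : End Q')).hom.hom.hom y
    rw [hkh]
  · rintro ⟨h, hh, hk⟩
    obtain ⟨k, hkh⟩ := hka h hh
    refine ⟨k, ?_⟩
    change (F.map (a k : End Q')).hom.hom.hom y = y'
    rw [hkh, hk]

end ThmA4Chart

end Literature.AnabelianGeometry.SemiGraphs
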